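/-
HONEST FRAMING: certified error envelopes and provably optimal rounding/accumulation schemes for
low-precision formats under stated cost models; every table by two implementations; no hardware
or vendor claims.
-/
import Summits.Ventures.CertifiedArithmetic.LowPrec.OptDemotion

/-!
# The demotion law (Theorem T8), part 2: sharpness and the ledger-facing statement

Part 1 (`OptDemotion`) proved `s ≤ (1 + u_p + (n-1) u_q)·fl_p(ŝ)` for recursive summation in the
wide format `F(q, emin)` demoted once to `F(p, emin)`.  Here: the bound is ATTAINED for every `n`
by `x₁ = 2^e (1+u_p)`, `x₂ = ⋯ = x_n = 2^(e-q)` under nearest maps resolving the two relevant kinds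
of ties the IEEE way (`TiesDownAtShift` for `fl_q` — roundTiesToEven does when `q ≥ p + 2` — and
`TiesEvenAtPow` for `fl_p`), such maps exist (`exists_roundNearest_tiesDownAtShift`), and the
two halves are packaged as `R4_DemotionLawSequential` (+ `_holds`).
-/

namespace Summit.Ventures.CertifiedArithmetic.LowPrec.Opt

open Literature.ComputerArithmetic.JeannerodRump2018

/-! ## Sharpness: the bound is attained -/

/-- TIES DOWN AT THE SHIFTED MIDPOINTS: the nearest map `fl` into `F(q, emin)` sends the midpoint
`2^e (1+u_p) + 2^e u_q` of the consecutive `q`-bit floats `2^e (1+u_p)` and `2^e (1+u_p+2u_q)` to the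
lower one, for every `e ≥ emin + q`.  IEEE roundTiesToEven does exactly this when `q ≥ p + 2`
(the lower candidate has the even significand `2^(q-1) + 2^(q-1-p)`); for `q = p + 1` it does not. -/
def TiesDownAtShift (p q : ℕ) (emin : ℤ) (fl : ℚ → ℚ) : Prop :=
  ∀ e : ℤ, emin + q ≤ e →
    fl ((2 : ℚ) ^ e + (2 : ℚ) ^ e * unitRoundoff p + (2 : ℚ) ^ e * unitRoundoff q)
      = (2 : ℚ) ^ e + (2 : ℚ) ^ e * unitRoundoff p

/-- The WITNESS: accumulator `2^e (1+u_p)` followed by `m` summands `2^e u_q = 2^(e-q)`; under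
`TiesDownAtShift` every addition is a tie resolved downwards, so the computed sum never moves. -/
theorem chainEval_witness {p q : ℕ} {emin : ℤ} {flq : ℚ → ℚ} (hT : TiesDownAtShift p q emin flq)
    {e : ℤ} (he : emin + q ≤ e) :
    ∀ m : ℕ, chainEval flq ((2 : ℚ) ^ e + (2 : ℚ) ^ e * unitRoundoff p)
      (List.replicate m ((2 : ℚ) ^ e * unitRoundoff q)) = (2 : ℚ) ^ e + (2 : ℚ) ^ e * unitRoundoff p
  | 0 => by simp
  | m + 1 => by
      rw [List.replicate_succ, chainEval_cons, hT e he]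
      exact chainEval_witness hT he m

/-- The witness summands are nonnegative floats of `F(q, emin)` (`1 ≤ p`, `q ≥ p + 1`, `e ≥ emin + q`):
`2^e (1+u_p) = (2^p + 1)·2^(e-p)` has `p + 1 ≤ q` bits and `2^e u_q = 2^(e-q)`. -/
theorem witness_isFloat {p q : ℕ} (hp : 1 ≤ p) (hpq : p + 1 ≤ q) {emin e : ℤ} (he : emin + q ≤ e) :
    (IsFloat q emin ((2 : ℚ) ^ e + (2 : ℚ) ^ e * unitRoundoff p) ∧
      0 ≤ (2 : ℚ) ^ e + (2 : ℚ) ^ e * unitRoundoff p) ∧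
    (IsFloat q emin ((2 : ℚ) ^ e * unitRoundoff q) ∧ 0 ≤ (2 : ℚ) ^ e * unitRoundoff q) := by
  have h2 : (2 : ℚ) ≠ 0 := by norm_num
  have hpow : (0 : ℚ) < (2 : ℚ) ^ e := zpow_pos (by norm_num) _
  refine ⟨⟨⟨2 ^ p + 1, e - p, ?_, by omega, ?_⟩, ?_⟩, ⟨⟨1, e - q, ?_, by omega, ?_⟩, ?_⟩⟩
  · rw [abs_of_nonneg (by positivity)]
    have h1 : (2 : ℤ) ^ p + 1 ≤ 2 ^ (p + 1) - 1 := by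
      have h4 : (2 : ℤ) ^ (p + 1) = 2 * 2 ^ p := by ring
      have h5 : (2 : ℤ) ≤ 2 ^ p := by
        calc (2 : ℤ) = 2 ^ 1 := by norm_num
          _ ≤ 2 ^ p := pow_le_pow_right₀ (by norm_num) hp
      linarith
    have h3 : (2 : ℤ) ^ (p + 1) ≤ 2 ^ q := pow_le_pow_right₀ (by norm_num) hpq
    linarith
  · unfold unitRoundoff
    rw [zpow_sub₀ h2, zpow_natCast]; push_cast
    field_simp
  · exact add_nonneg hpow.le (mul_nonneg hpow.le (unitRoundoff_nonneg p))
  · have h1 : (2 : ℤ) ≤ 2 ^ q := by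
      calc (2 : ℤ) = 2 ^ 1 := by norm_num
        _ ≤ 2 ^ q := pow_le_pow_right₀ (by norm_num) (by omega)
    rw [abs_one]; linarith
  · unfold unitRoundoff
    rw [zpow_sub₀ h2, zpow_natCast]; push_cast
    ring
  · exact mul_nonneg hpow.le (unitRoundoff_nonneg q)

/-- THE DEMOTION LAW IS ATTAINED (Theorem T8(a), sharpness): with `fl_q` tie-down at the shifted
midpoints and `fl_p` ties-to-even at the binade points, the witness with `m` small summands has
`fl_p(ŝ) = 2^e` and exact sum `(1 + u_p + m·u_q)·2^e` — equality in `exact_le_demotion_sequential`. -/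
theorem demotion_sequential_attained {p q : ℕ} {emin : ℤ} {flq flp : ℚ → ℚ}
    (hT : TiesDownAtShift p q emin flq) (hE : TiesEvenAtPow p emin flp) {e : ℤ} (he : emin + q ≤ e)
    (m : ℕ) :
    let x := (2 : ℚ) ^ e + (2 : ℚ) ^ e * unitRoundoff p
    let ys := List.replicate m ((2 : ℚ) ^ e * unitRoundoff q)
    flp (chainEval flq x ys) = (2 : ℚ) ^ e ∧
    x + ys.sum = (1 + unitRoundoff p + (ys.length : ℚ) * unitRoundoff q) * flp (chainEval flq x ys) := by
  intro x ys
  have hc : chainEval flq x ys = x := chainEval_witness hT he m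
  have hr : flp x = (2 : ℚ) ^ e := hE e (by omega)
  refine ⟨by rw [hc, hr], ?_⟩
  rw [hc, hr]
  simp only [ys, x, List.sum_replicate, List.length_replicate, nsmul_eq_mul]
  ring

/-! ## Such nearest maps exist (the sharpness hypotheses are consistent with nearest rounding) -/

/-- `2^e (1+u_p)` is a nearest float of `F(q, emin)` to the shifted midpoint `2^e(1+u_p) + 2^e u_q`
(`q ≥ p + 1`, any `e`): floats above `2^e (1+u_p)` are at least one grid step `2^(e+1-q)`
higher, floats below are at least `2^e u_q` away. -/
theorem abs_shift_midpoint_sub_le {p q : ℕ} (hq : 1 ≤ q) (hpq : p + 1 ≤ q) {emin : ℤ} (e : ℤ)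
    {f : ℚ} (hf : IsFloat q emin f) :
    |((2 : ℚ) ^ e + (2 : ℚ) ^ e * unitRoundoff p + (2 : ℚ) ^ e * unitRoundoff q)
        - ((2 : ℚ) ^ e + (2 : ℚ) ^ e * unitRoundoff p)|
      ≤ |((2 : ℚ) ^ e + (2 : ℚ) ^ e * unitRoundoff p + (2 : ℚ) ^ e * unitRoundoff q) - f| := by
  have h2 : (2 : ℚ) ≠ 0 := by norm_num
  set v : ℚ := (2 : ℚ) ^ e + (2 : ℚ) ^ e * unitRoundoff p with hv
  set d : ℚ := (2 : ℚ) ^ e * unitRoundoff q with hd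
  have hd' : d = (2 : ℚ) ^ (e - q) := by
    rw [hd]; unfold unitRoundoff; rw [zpow_sub₀ h2, zpow_natCast]; ring
  have hdpos : 0 < d := by rw [hd']; exact zpow_pos (by norm_num) _
  have hstep : (2 : ℚ) ^ (e + 1 - q) = 2 * d := by
    rw [hd', show e + 1 - (q : ℤ) = (e - q) + 1 by ring, zpow_add_one₀ h2]; ring
  rw [show v + d - v = d by ring, abs_of_pos hdpos]
  -- v = N · 2^(e+1-q) with N = 2^(q-1) + 2^(q-1-p)
  have hpow : (0 : ℚ) < (2 : ℚ) ^ e := zpow_pos (by norm_num) _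
  have hve : (2 : ℚ) ^ e < v ∨ (2 : ℚ) ^ e = v := by
    rw [hv]; have := unitRoundoff_nonneg p
    rcases eq_or_lt_of_le this with h | h
    · right; rw [← h]; ring
    · left; have := mul_pos hpow h; linarith
  rcases le_or_gt f v with hle | hgt
  · -- f ≤ v: distance ≥ d
    rw [abs_of_nonneg (by linarith)]; linarith
  · -- f > v ≥ 2^e: f is a multiple of the grid step above 2^e
    have hfe : (2 : ℚ) ^ e < f := by rcases hve with h | h <;> linarith
    obtain ⟨n, hn⟩ := exists_int_mul_of_lt (isFloatU_of_isFloat hf) hfe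
    -- v = N * step
    have hN : v = (((2 : ℤ) ^ (q - 1) + 2 ^ (q - 1 - p) : ℤ) : ℚ) * (2 : ℚ) ^ (e + 1 - q) := by
      rw [hv]; unfold unitRoundoff; push_cast
      rw [show (e + 1 - (q : ℤ)) = e + ((1 : ℤ) - q) by ring, zpow_add₀ h2,
        ← zpow_natCast (2 : ℚ) (q - 1), ← zpow_natCast (2 : ℚ) (q - 1 - p),
        show ((q - 1 : ℕ) : ℤ) = (q : ℤ) - 1 by omega,
        show ((q - 1 - p : ℕ) : ℤ) = (q : ℤ) - 1 - p by omega,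
        zpow_sub₀ h2, zpow_sub₀ h2, zpow_sub₀ h2, zpow_sub₀ h2, zpow_natCast, zpow_natCast, zpow_one]
      field_simp
    have hstep_pos : (0 : ℚ) < (2 : ℚ) ^ (e + 1 - q) := zpow_pos (by norm_num) _
    have hnN : (((2 : ℤ) ^ (q - 1) + 2 ^ (q - 1 - p) : ℤ) : ℚ) < (n : ℚ) := by
      rw [hn, hN] at hgt
      exact lt_of_mul_lt_mul_right hgt hstep_pos.le
    have hnN' : ((2 : ℤ) ^ (q - 1) + 2 ^ (q - 1 - p)) + 1 ≤ n := by
      have : ((2 : ℤ) ^ (q - 1) + 2 ^ (q - 1 - p)) < n := by exact_mod_cast hnN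
      omega
    have hge : v + 2 * d ≤ f := by
      rw [hn, hN, ← hstep]
      have : ((((2 : ℤ) ^ (q - 1) + 2 ^ (q - 1 - p)) + 1 : ℤ) : ℚ) * (2 : ℚ) ^ (e + 1 - q)
          ≤ (n : ℚ) * (2 : ℚ) ^ (e + 1 - q) :=
        mul_le_mul_of_nonneg_right (by exact_mod_cast hnN') hstep_pos.le
      push_cast at this ⊢; linarith
    rw [abs_of_nonpos (by linarith)]; linarith

/-- NEAREST MAPS WITH TIES-DOWN AT THE SHIFTED MIDPOINTS EXIST (`q ≥ p + 1`): modify any nearest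
map at those midpoints.  So the sharpness hypothesis `TiesDownAtShift` is consistent. -/
theorem exists_roundNearest_tiesDownAtShift {p q : ℕ} (hp : 1 ≤ p) (hq : 1 ≤ q) (hpq : p + 1 ≤ q)
    (emin : ℤ) :
    ∃ fl : ℚ → ℚ, IsRoundNearest q emin fl ∧ TiesDownAtShift p q emin fl := by
  classical
  obtain ⟨fl₀, hfl₀⟩ := exists_roundNearest q emin
  let P : ℚ → Prop := fun t => ∃ e : ℤ, emin + q ≤ e ∧
    t = (2 : ℚ) ^ e + (2 : ℚ) ^ e * unitRoundoff p + (2 : ℚ) ^ e * unitRoundoff q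
  let g : ℚ → ℚ := fun t => if h : P t then
    (2 : ℚ) ^ (Classical.choose h) + (2 : ℚ) ^ (Classical.choose h) * unitRoundoff p else fl₀ t
  have hinj : ∀ {e e' : ℤ},
      (2 : ℚ) ^ e + (2 : ℚ) ^ e * unitRoundoff p + (2 : ℚ) ^ e * unitRoundoff q
        = (2 : ℚ) ^ e' + (2 : ℚ) ^ e' * unitRoundoff p + (2 : ℚ) ^ e' * unitRoundoff q → e = e' := by
    intro e e' h
    have hc : (0 : ℚ) < 1 + unitRoundoff p + unitRoundoff q := by
      linarith [unitRoundoff_nonneg p, unitRoundoff_nonneg q]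
    have h' : (2 : ℚ) ^ e * (1 + unitRoundoff p + unitRoundoff q)
        = (2 : ℚ) ^ e' * (1 + unitRoundoff p + unitRoundoff q) := by linarith
    have h'' : (2 : ℚ) ^ e = (2 : ℚ) ^ e' := mul_right_cancel₀ hc.ne' h'
    exact zpow_right_injective₀ (by norm_num) (by norm_num) h''
  refine ⟨g, ?_, ?_⟩
  · intro t
    by_cases h : P t
    · simp only [g, dif_pos h]
      obtain ⟨he, ht⟩ := Classical.choose_spec h
      refine ⟨(witness_isFloat hp hpq he).1.1, fun f hf => ?_⟩
      have key := abs_shift_midpoint_sub_le hq hpq (Classical.choose h) hf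
      rw [← ht] at key
      exact key
    · simp only [g, dif_neg h]; exact hfl₀ t
  · intro e he
    have h : P ((2 : ℚ) ^ e + (2 : ℚ) ^ e * unitRoundoff p + (2 : ℚ) ^ e * unitRoundoff q) :=
      ⟨e, he, rfl⟩
    simp only [g, dif_pos h]
    obtain ⟨-, ht⟩ := Classical.choose_spec h
    rw [hinj ht.symm]

/-! ## Every tree: the product bound -/

open Literature.ComputerArithmetic.JeannerodRump2018.SumTree in
/-- DEMOTING ANY WIDE-FORMAT SUMMATION TREE (Theorem T8(b), upper bound): for every summation tree
`t` with nonnegative leaves in `F(q, emin)` evaluated with a nearest rounding `fl_q` and demoted once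
by a nearest rounding `fl_p`, `exact t ≤ (1 + u_p) · M_t(u_q) · fl_p(ŝ)` (`M_t` = the tree
polynomial of Theorem T4).  This is Theorem U composed with one demotion step `ŝ ≤ (1+u_p) fl_p ŝ`;
it is NOT sharp in general (for the recursive tree the exact constant is `1 + u_p + (n-1) u_q <
(1 + u_p)(1 + (n-1) u_q)`, part 1), the exact constant `Q_t` of OPTIMA.md T8(b) lies in
`[M_t(u_q) + u_p, (1 + u_p) M_t(u_q)]`. -/
theorem exact_le_demotion_tree {p q : ℕ} (hp : 1 ≤ p) (hq : 1 ≤ q) {emin : ℤ} {flq flp : ℚ → ℚ}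
    (hflq : IsRoundNearest q emin flq) (hflp : IsRoundNearest p emin flp) (t : SumTree)
    (ht : ∀ x ∈ leaves t, IsFloat q emin x ∧ 0 ≤ x) :
    exact t ≤ (1 + unitRoundoff p) * treeM (unitRoundoff q) t * flp (eval flq t) := by
  obtain ⟨h1, hF, h0⟩ := exact_le_treeM_mul_eval (unitRoundoff_nonneg q) (IsFloat q emin) flq
    (fun s => (hflq s).1) (fun _ _ ha hb ha0 hb0 => max_le_fl_add hflq ha hb ha0 hb0)
    (fun _ _ ha hb ha0 hb0 => add_le_one_add_u_mul_fl hq hflq ha hb ha0 hb0) t ht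
  set c := eval flq t with hc
  have hM : 0 ≤ treeM (unitRoundoff q) t := le_trans zero_le_one (one_le_treeM (unitRoundoff_nonneg q) t)
  have hup0 := unitRoundoff_nonneg p
  -- one demotion step: c ≤ (1 + u_p) fl_p c
  have hstep : c ≤ (1 + unitRoundoff p) * flp c := by
    by_cases hsmallp : c < (2 : ℚ) ^ (emin + p)
    · rw [fl_eq_self hflp (isFloat_narrow_of_small hF h0 hsmallp)]
      nlinarith [mul_nonneg hup0 h0]
    · have hbig : (2 : ℚ) ^ (emin + p) ≤ c := not_lt.mp hsmallp
      have hpos : 0 < c := lt_of_lt_of_le (zpow_pos (by norm_num) _) hbig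
      set K := Int.log 2 c with hK
      have hlow : ((2 : ℕ) : ℚ) ^ K ≤ c := Int.zpow_log_le_self (by norm_num) hpos
      have hupK : c < ((2 : ℕ) : ℚ) ^ (K + 1) := Int.lt_zpow_succ_log_self (by norm_num) _
      push_cast at hlow hupK
      have hKe : emin + p ≤ K + 1 := by
        by_contra hlt
        have : (2 : ℚ) ^ (K + 1) ≤ (2 : ℚ) ^ (emin + (p : ℤ)) :=
          zpow_le_zpow_right₀ (by norm_num) (by omega)
        linarith
      have herr := abs_sub_fl_le_half_ulp hp hflp hlow hupK hKe
      have hr_ge : (2 : ℚ) ^ K ≤ flp c :=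
        le_fl_of_isFloat_le hflp (PTree.isFloat_two_zpow hp (by omega)) hlow
      have hcr : c - flp c ≤ unitRoundoff p * (2 : ℚ) ^ K := le_trans (le_abs_self _) herr
      nlinarith [mul_le_mul_of_nonneg_left hr_ge hup0]
  calc exact t ≤ treeM (unitRoundoff q) t * c := h1
    _ ≤ treeM (unitRoundoff q) t * ((1 + unitRoundoff p) * flp c) :=
        mul_le_mul_of_nonneg_left hstep hM
    _ = (1 + unitRoundoff p) * treeM (unitRoundoff q) t * flp c := by ring

/-! ## Ledger-facing statement -/

/-- R4/T8 (OPTIMA.md §B Theorem T8(a)): THE DEMOTION LAW for recursive summation — for all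
precisions `p, q ≥ 1`, every nearest rounding `fl_q` into the wide format and `fl_p` into the narrow
one, and all nonnegative wide-format summands, `s ≤ (1 + u_p + (n-1) u_q)·fl_p(ŝ)`; and for
`q ≥ p + 1` there are nearest maps (those with IEEE-style tie resolution at the two kinds of
midpoints) and summands attaining equality, for every `n`. -/
def R4_DemotionLawSequential : Prop :=
  (∀ (p q : ℕ), 1 ≤ p → 1 ≤ q → ∀ (emin : ℤ) (flq flp : ℚ → ℚ),
    IsRoundNearest q emin flq → IsRoundNearest p emin flp →
    ∀ (x : ℚ) (ys : List ℚ), IsFloat q emin x → 0 ≤ x → (∀ y ∈ ys, IsFloat q emin y ∧ 0 ≤ y) →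
      x + ys.sum ≤ (1 + unitRoundoff p + (ys.length : ℚ) * unitRoundoff q) * flp (chainEval flq x ys)) ∧
  (∀ (p q : ℕ), 1 ≤ p → p + 1 ≤ q → ∀ (emin : ℤ) (m : ℕ),
    ∃ (flq flp : ℚ → ℚ) (x : ℚ) (ys : List ℚ),
      IsRoundNearest q emin flq ∧ IsRoundNearest p emin flp ∧
      IsFloat q emin x ∧ 0 ≤ x ∧ (∀ y ∈ ys, IsFloat q emin y ∧ 0 ≤ y) ∧ ys.length = m ∧
      0 < flp (chainEval flq x ys) ∧
      x + ys.sum = (1 + unitRoundoff p + (m : ℚ) * unitRoundoff q) * flp (chainEval flq x ys))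

/-- Proof of `R4_DemotionLawSequential`. -/
theorem R4_DemotionLawSequential_holds : R4_DemotionLawSequential := by
  refine ⟨fun p q hp hq emin flq flp hflq hflp x ys hx hx0 hys =>
    exact_le_demotion_sequential hp hq hflq hflp x ys hx hx0 hys, ?_⟩
  intro p q hp hpq emin m
  have hq : 1 ≤ q := by omega
  obtain ⟨flq, hflq, hT⟩ := exists_roundNearest_tiesDownAtShift hp hq hpq emin
  obtain ⟨flp, hflp, hE⟩ := exists_roundNearest_tiesEven hp emin
  have he : emin + q ≤ emin + q := le_rfl
  obtain ⟨hr, hsum⟩ := demotion_sequential_attained hT hE he m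
  have hw := witness_isFloat hp hpq he
  refine ⟨flq, flp, (2 : ℚ) ^ (emin + q) + (2 : ℚ) ^ (emin + q) * unitRoundoff p,
    List.replicate m ((2 : ℚ) ^ (emin + q) * unitRoundoff q), hflq, hflp, hw.1.1, hw.1.2,
    fun y hy => ?_, by simp, ?_, ?_⟩
  · rw [List.eq_of_mem_replicate hy]; exact hw.2
  · rw [hr]; exact zpow_pos (by norm_num) _
  · simpa using hsum

end Summit.Ventures.CertifiedArithmetic.LowPrec.Opt
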